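import Literature.Computability.AlgebraicComplexity.BorderRankMatMulThreeHalves
import Literature.Computability.AlgebraicComplexity.PartialMatrixMultiplicationProofs
import HarnessLib

/-!
# Bürgisser–Ikenmeyer 2013, Thm. 4.5: `R̲(M_m) ≥ 3m²/2 − 1/2` (`m` odd), `≥ 3m²/2 − 2` (`m` even) — the hook-obstruction bound, proved here from the Koszul-flattening bound

Topic `Literature/Computability/AlgebraicComplexity` (cell `pub-gct-max`, track T, typed chain;
honest framing of that cell: multiplicity data and certified rank bounds at small parameters;
nothing here is a claim on VP vs VNP or P vs NP).

P. Bürgisser, C. Ikenmeyer, *Explicit lower bounds via geometric complexity theory*, STOC 2013,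
141–150 = arXiv:1210.8368 [BurgisserIkenmeyer2013], **Thm. 4.5** (label `thm:hooklowerbound`,
`[tex:1210.8368 stoc172fp-burgisser.tex L1010–1014]`): "We have `R̲(M_m) ≥ (3/2) m² − 1/2` if `m` is
odd. Moreover, `R̲(M_m) ≥ (3/2) m² − 2` if `m` is even." There it is obtained by the method of
Mulmuley–Sohoni OCCURRENCE obstructions: Thm. 4.1 (obstruction designs `ℋ` give highest weight
vectors `f_ℋ` spanning `HWV_{λ^*}(Sym^d ⊗³(ℂ^*)^n)`), Prop. 4.2 (`f_ℋ(w) = 0` whenever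
`R̲(w) < χ'(ℋ)`, the chromatic index), Lemma 4.4 (`f_{ℋ_κ}(A M_m) ≠ 0` for the "3-dimensional hook"
design `ℋ_κ`, `κ = (m²−1)/2`, `m > 1` odd), so that "`mult_{λ(κ)}(𝒪(\overline{GL_n³ E_n})_d) = 0`"
(Remark after Thm. 4.5): the weight `λ(κ)` is an occurrence obstruction in the sense of
Mulmuley–Sohoni 2008, Def. 1.2 against `M_m ∈ σ_{3κ}` ("occurence obstruction … as introduced by
Mulmuley and Sohoni [gct2, Def. 1.2]", `[L713–719]`; "HWV obstruction", Prop. 3.3 `[L658–696]`).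

THIS FILE DOES NOT FORMALISE THAT METHOD (no obstruction designs, no `f_ℋ`). It records the printed
BOUND as a named, PROVED statement for the tree's algebraic border rank `algBorderRank` over any
field of characteristic `0`, as the corollary of the STRONGER bound already in the tree by a different
route — Strassen 1983 / Bürgisser–Clausen–Shokrollahi 1997 Cor. (19.14) via the `p = 1` Koszul
flattening, `three_mul_sq_le_two_mul_algBorderRank_matMulTensor : 2 ≤ n → 3·n·n ≤ 2·bR(⟨n,n,n⟩)`
(`BorderRankMatMulThreeHalves.lean`) — together with `bR(⟨1,1,1⟩) ≥ 1`
(`one_le_algBorderRank_of_ne_zero`). In the form without fractions: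
`m` odd ⇒ `3m² ≤ 2·bR(M_m) + 1`; `m` even ⇒ `3m² ≤ 2·bR(M_m) + 4`.

References. [BurgisserIkenmeyer2013] loc. cit.; [BurgisserClausenShokrollahi1997] Cor. (19.14);
[Landsberg2014] §4.
-/

noncomputable section

namespace Literature.Computability.AlgebraicComplexity

universe u

variable (K : Type u) [Field K] [CharZero K]

/-- The matrix multiplication tensor `⟨1,1,1⟩` is nonzero (its single entry is `1`). [folklore] -/
private theorem matMulTensor_one_ne_zero : matMulTensor K 1 1 1 ≠ 0 := by
  intro h
  have := congrFun (congrFun (congrFun h (0, 0)) (0, 0)) (0, 0)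
  simp [matMulTensor] at this

/-- **Bürgisser–Ikenmeyer 2013, Thm. 4.5** ("We have `R̲(M_m) ≥ (3/2) m² − 1/2` if `m` is odd.
Moreover, `R̲(M_m) ≥ (3/2) m² − 2` if `m` is even."), for the algebraic border rank of the matrix
multiplication tensor `⟨m,m,m⟩` over any field of characteristic `0`, cleared of denominators:
`Odd m → 3m² ≤ 2·bR + 1` and `Even m → 3m² ≤ 2·bR + 4`. Proved NOT by the paper's occurrence
obstructions but as a corollary of the tree's Koszul-flattening bound `3n² ≤ 2·bR(⟨n,n,n⟩)` (`n ≥ 2`,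
BCS 1997 Cor. (19.14)) and `bR(⟨1,1,1⟩) ≥ 1`.
[cite: BurgisserIkenmeyer2013, Thm. 4.5 (arXiv:1210.8368, label thm:hooklowerbound)]
[cite: BurgisserClausenShokrollahi1997, Cor. (19.14) (p. 515)] -/
theorem BurgisserIkenmeyer2013_thm_4_5 (m : ℕ) :
    (Odd m → 3 * m ^ 2 ≤ 2 * algBorderRank (matMulTensor K m m m) + 1) ∧
    (Even m → 3 * m ^ 2 ≤ 2 * algBorderRank (matMulTensor K m m m) + 4) := by
  rcases Nat.lt_or_ge m 2 with hm | hm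
  · interval_cases m
    · exact ⟨fun h => absurd h (by decide), fun _ => by simp⟩
    · refine ⟨fun _ => ?_, fun h => absurd h (by decide)⟩
      have h1 := one_le_algBorderRank_of_ne_zero (matMulTensor_one_ne_zero K)
      omega
  · have h := three_mul_sq_le_two_mul_algBorderRank_matMulTensor K m hm
    rw [sq]
    exact ⟨fun _ => by linarith, fun _ => by linarith⟩

end Literature.Computability.AlgebraicComplexity
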